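import Literature.NumberTheory.EllipticCurves.TunnellWaldspurgerCorollaryProofs
import Literature.NumberTheory.EllipticCurves.TunnellThmTwoChi2Proofs
import HarnessLib

/-!
# `tunnell_converse_even` and Tunnell's Theorem 3 (even twists) from Waldspurger's Corollaire 2 ALONE

Sibling proof file of `BSDAnalyticRank` (the named fact
`Literature.NumberTheory.EllipticCurves.tunnell_converse_even`, **bsd.S29**, even case) and of
`TunnellWaldspurgerCorollaryProofs`. That file reduced the four equivalent even-case leaves of
Tunnell's theorem (`Tunnell1983_b_sq_propto_L_one` ⇔ `Tunnell1983_waldspurger_chi2` ⇔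
`Tunnell1983_b_sq_eq_const_mul_L_one` ⇔ `Tunnell1983_L_one_even`, cf.
`TunnellLeavesEquivalenceProofs`) and `tunnell_converse_even` itself to TWO inputs: Tunnell's
Theorem 2 for the character `χ₂` (`Tunnell1983_thm2_chi2`) and Waldspurger's Corollaire 2
[Waldspurger 1981, Cor. 2; Purkait 2013, Cor. 5.2] at `(N, k, χ, φ) = (128, 3/2, χ₂, φ₃₂)`, stated
inline. Theorem 2 (`χ₂`) is now a theorem of the tree
(`TunnellThmTwoChi2Proofs.Tunnell1983_thm2_chi2_holds`), so the even half of Tunnell's theorem —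
Theorem 3 for even twists, the Waldspurger leaves, and the converse `tunnell_converse_even` — rests
on exactly ONE unformalised input, Waldspurger's relation between the Fourier coefficients of
`g θ₄ = ∑ b(n) qⁿ` and the central values `L(E²ⁿ, 1)`:

  for odd square-free `n₁ ≡ n₂ (mod 8)`:
  `b(n₁)² · L(E^{2n₂}, 1) · √n₂ = b(n₂)² · L(E^{2n₁}, 1) · √n₁`            (W)

(Corollaire 2 for `f = g θ₄ ∈ S_{3/2}(128, χ₂, φ)`: `n₁/n₂ ∈ (ℚ₂ˣ)²` iff `n₁ ≡ n₂ (mod 8)` for odd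
square-free `nᵢ`, `χ₂(n₂/n₁) = 1`, `χ₀ = χ₂ χ₋₄`, `L(φ χ₀⁻¹ χ_{n}, 1) = L(φ ⊗ χ₂χ₋₄χₙ, 1) = L(E²ⁿ, 1)`,
Tunnell p. 329, ll. 22–27.) This file records that reduction as theorems with (W) as their only
hypothesis:

* `Tunnell1983_b_sq_propto_L_one_of_b_sq_relation` — (W) ⇒ `Tunnell1983_b_sq_propto_L_one`
  (`c₁ = 1/L(E², 1)`, `c₅ = 4/(L(E¹⁰, 1) √5)`; the two `L`-values are non-zero theorems of the tree);
* `Tunnell1983_waldspurger_chi2_of_b_sq_relation`, `Tunnell1983_b_sq_eq_const_mul_L_one_of_b_sq_relation`,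
  `Tunnell1983_L_one_even_of_b_sq_relation` (Theorem 3, even twists:
  `L(E²ᵈ, 1) = b(d)² β / (2 √(2d))`), `tunnell_converse_even_of_b_sq_relation`;
* the same four conclusions from Corollaire 2 in the form used by
  `TunnellWaldspurgerCorollaryProofs` (all `f ∈ S_{3/2}(128, χ₂, φ)`), now without the Theorem 2
  hypothesis: `…_of_waldspurgerCor`.

Conversely (W) follows from `Tunnell1983_L_one_even` (`b_sq_relation_of_L_one_even`), so (W) is
EQUIVALENT to each of the four leaves: it is the precise remaining content of Waldspurger's theorem
for this problem. No definitions, no named facts.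

## References

* J. B. Tunnell, *A classical Diophantine problem and modular forms of weight 3/2*, Invent. Math.
  72 (1983) 323–334, Theorem (Waldspurger) p. 328, proof of Thm 3 p. 329, §3 p. 330.
  [Tunnell1983Congruent]
* J.-L. Waldspurger, *Sur les coefficients de Fourier des formes modulaires de poids demi-entier*,
  J. Math. Pures Appl. 60 (1981) 375–484, Thm 1 and Corollaire 2. [Waldspurger1981Fourier]
* S. Purkait, *Explicit application of Waldspurger's theorem*, LMS J. Comput. Math. 16 (2013)
  216–245, Thm 7 and Cor. 5.2. [arXiv:1208.4329]
* N. Koblitz, *Introduction to Elliptic Curves and Modular Forms*, GTM 97 (2nd ed. 1993), Ch. IV §4,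
  Theorem (Tunnell). [KoblitzECMF1993]
-/

noncomputable section

open Complex

namespace Literature.NumberTheory.EllipticCurves

open Tunnell1983 ModularForms

/-! ### Waldspurger's relation (W) for `g θ₄` implies the four even-case leaves -/

/-- **`Tunnell1983_b_sq_propto_L_one` from Waldspurger's relation (W) for the coefficients of
`g θ₄` alone**: apply (W) to the pairs `(n, 1)` and `(n, 5)` and use `b(1) = 1`, `b(5) = 2`,
`L(E², 1) ≠ 0`, `L(E¹⁰, 1) ≠ 0` (theorems of the tree), giving `c₁ = 1/L(E², 1)` and
`c₅ = 4/(L(E¹⁰, 1) √5)`. [cite: Waldspurger1981Fourier, Corollaire 2]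
[cite: Tunnell1983Congruent, p. 329, ll. 22–27] -/
theorem Tunnell1983_b_sq_propto_L_one_of_b_sq_relation
    (hW : ∀ ⦃n₁ n₂ : ℕ⦄, Odd n₁ → Squarefree n₁ → Squarefree n₂ → n₁ % 8 = n₂ % 8 →
      (congruentNumberCurve (2 * n₁)).HasEntireLFunction →
      (congruentNumberCurve (2 * n₂)).HasEntireLFunction →
      (Tunnell1983.b n₁ : ℂ) ^ 2 * (congruentNumberCurve (2 * n₂)).entireLFunction 1 *
          (Real.sqrt n₂ : ℂ) =
        (Tunnell1983.b n₂ : ℂ) ^ 2 * (congruentNumberCurve (2 * n₁)).entireLFunction 1 *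
          (Real.sqrt n₁ : ℂ)) :
    Tunnell1983_b_sq_propto_L_one := by
  have hsq2 : Squarefree (2 * 1) := by rw [Nat.mul_one]; exact Nat.prime_two.prime.squarefree
  have hsq10 : Squarefree (2 * 5) :=
    squarefree_two_mul_of_odd Nat.prime_five.prime.squarefree (by decide)
  have hL2 := entireLFunction_congruentNumberCurve_two_one_ne_zero
  have hL10 := entireLFunction_congruentNumberCurve_ten_one_ne_zero
  refine ⟨((congruentNumberCurve 2).entireLFunction 1)⁻¹,
    4 * ((congruentNumberCurve 10).entireLFunction 1 * (Real.sqrt 5 : ℂ))⁻¹, fun n hn hL ↦ ⟨?_, ?_⟩⟩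
  · intro h1
    have hodd : Odd n := Nat.odd_iff.mpr (by omega)
    have key := hW hodd hn squarefree_one (by omega) hL
      (hasEntireLFunction_congruentNumberCurve_holds hsq2)
    rw [b_one, Nat.mul_one, Nat.cast_one, Real.sqrt_one] at key
    push_cast at key
    rw [one_pow, one_mul, mul_one] at key
    rw [mul_assoc, ← key]
    field_simp
  · intro h5
    have hodd : Odd n := Nat.odd_iff.mpr (by omega)
    have key := hW hodd hn Nat.prime_five.prime.squarefree (by omega) hL
      (hasEntireLFunction_congruentNumberCurve_holds hsq10)
    rw [b_five, show (2 * 5 : ℕ) = 10 from rfl] at key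
    push_cast at key
    have hs5 : (Real.sqrt 5 : ℂ) ≠ 0 := Complex.ofReal_ne_zero.mpr (by positivity)
    rw [show (Tunnell1983.b n : ℂ) ^ 2 = (Tunnell1983.b n : ℂ) ^ 2 *
      (congruentNumberCurve 10).entireLFunction 1 * (Real.sqrt 5 : ℂ) *
      ((congruentNumberCurve 10).entireLFunction 1 * (Real.sqrt 5 : ℂ))⁻¹ by field_simp, key]
    ring

/-- **`Tunnell1983_waldspurger_chi2` from Waldspurger's relation (W)**, through
`Tunnell1983_waldspurger_chi2_iff_propto` (which uses the memberships of Theorem 2, proved in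
`TunnellFormsCuspidalProofs`). [cite: Waldspurger1981Fourier, Thm 1 and Corollaire 2]
[cite: Tunnell1983Congruent, pp. 328–329] -/
theorem Tunnell1983_waldspurger_chi2_of_b_sq_relation
    (hW : ∀ ⦃n₁ n₂ : ℕ⦄, Odd n₁ → Squarefree n₁ → Squarefree n₂ → n₁ % 8 = n₂ % 8 →
      (congruentNumberCurve (2 * n₁)).HasEntireLFunction →
      (congruentNumberCurve (2 * n₂)).HasEntireLFunction →
      (Tunnell1983.b n₁ : ℂ) ^ 2 * (congruentNumberCurve (2 * n₂)).entireLFunction 1 *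
          (Real.sqrt n₂ : ℂ) =
        (Tunnell1983.b n₂ : ℂ) ^ 2 * (congruentNumberCurve (2 * n₁)).entireLFunction 1 *
          (Real.sqrt n₁ : ℂ)) :
    Tunnell1983_waldspurger_chi2 :=
  Tunnell1983_waldspurger_chi2_iff_propto.mpr (Tunnell1983_b_sq_propto_L_one_of_b_sq_relation hW)

/-- **`Tunnell1983_b_sq_eq_const_mul_L_one` from Waldspurger's relation (W)** (the third conjunct,
`L(E²ⁿ, 1) = 0` for `n ≡ 3, 7 (8)`, being the root-number theorem of
`CongruentNumberCurveRootNumberEven`). [cite: Waldspurger1981Fourier, Corollaire 2]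
[cite: Tunnell1983Congruent, p. 329, ll. 22–27] -/
theorem Tunnell1983_b_sq_eq_const_mul_L_one_of_b_sq_relation
    (hW : ∀ ⦃n₁ n₂ : ℕ⦄, Odd n₁ → Squarefree n₁ → Squarefree n₂ → n₁ % 8 = n₂ % 8 →
      (congruentNumberCurve (2 * n₁)).HasEntireLFunction →
      (congruentNumberCurve (2 * n₂)).HasEntireLFunction →
      (Tunnell1983.b n₁ : ℂ) ^ 2 * (congruentNumberCurve (2 * n₂)).entireLFunction 1 *
          (Real.sqrt n₂ : ℂ) =
        (Tunnell1983.b n₂ : ℂ) ^ 2 * (congruentNumberCurve (2 * n₁)).entireLFunction 1 *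
          (Real.sqrt n₁ : ℂ)) :
    Tunnell1983_b_sq_eq_const_mul_L_one :=
  Tunnell1983_b_sq_eq_const_mul_L_one_of_propto (Tunnell1983_b_sq_propto_L_one_of_b_sq_relation hW)

/-- **Tunnell's Theorem 3, even twists (`Tunnell1983_L_one_even`:
`L(E²ᵈ, 1) = b(d)² β / (2 √(2d))` for odd square-free `d`) from Waldspurger's relation (W) alone** —
Theorem 2, the two `L`-values `L(E², 1) = β/(2√2)`, `L(E¹⁰, 1) = 2β/√10`
(`BirchSwinnertonDyer1965_L_one_two_ten_holds`) and the continuation of `L(E_n, s)` being theorems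
of the tree. [cite: Tunnell1983Congruent, Thm 3 and its proof, p. 329]
[cite: Waldspurger1981Fourier, Corollaire 2] -/
theorem Tunnell1983_L_one_even_of_b_sq_relation
    (hW : ∀ ⦃n₁ n₂ : ℕ⦄, Odd n₁ → Squarefree n₁ → Squarefree n₂ → n₁ % 8 = n₂ % 8 →
      (congruentNumberCurve (2 * n₁)).HasEntireLFunction →
      (congruentNumberCurve (2 * n₂)).HasEntireLFunction →
      (Tunnell1983.b n₁ : ℂ) ^ 2 * (congruentNumberCurve (2 * n₂)).entireLFunction 1 *
          (Real.sqrt n₂ : ℂ) =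
        (Tunnell1983.b n₂ : ℂ) ^ 2 * (congruentNumberCurve (2 * n₁)).entireLFunction 1 *
          (Real.sqrt n₁ : ℂ)) :
    Tunnell1983_L_one_even :=
  Tunnell1983_L_one_even_of_propto (Tunnell1983_b_sq_propto_L_one_of_b_sq_relation hW)
    BirchSwinnertonDyer1965_L_one_two_ten_holds

/-- **`tunnell_converse_even`** (bsd.S29, converse, even case: under BSD(RANK), the count identity
`#{8x²+2y²+16z² = n} = 2 #{8x²+2y²+64z² = n}` for even square-free `n` makes `n` congruent)
**from Waldspurger's relation (W) alone.** The class `n ≡ 6 (mod 8)` is unconditional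
(`tunnell_converse_even_of_mod_eight_six`, root number `-1`); (W) serves the class `n ≡ 2 (mod 8)`.
[cite: KoblitzECMF1993, Ch. IV §4, Theorem (Tunnell)] [cite: Tunnell1983Congruent, §3 (p. 330)]
[cite: Waldspurger1981Fourier, Corollaire 2] -/
theorem tunnell_converse_even_of_b_sq_relation
    (hW : ∀ ⦃n₁ n₂ : ℕ⦄, Odd n₁ → Squarefree n₁ → Squarefree n₂ → n₁ % 8 = n₂ % 8 →
      (congruentNumberCurve (2 * n₁)).HasEntireLFunction →
      (congruentNumberCurve (2 * n₂)).HasEntireLFunction →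
      (Tunnell1983.b n₁ : ℂ) ^ 2 * (congruentNumberCurve (2 * n₂)).entireLFunction 1 *
          (Real.sqrt n₂ : ℂ) =
        (Tunnell1983.b n₂ : ℂ) ^ 2 * (congruentNumberCurve (2 * n₁)).entireLFunction 1 *
          (Real.sqrt n₁ : ℂ)) :
    tunnell_converse_even :=
  tunnell_converse_even_of_propto (Tunnell1983_b_sq_propto_L_one_of_b_sq_relation hW)

/-! ### Conversely, (W) follows from Theorem 3 (even twists): (W) is equivalent to the leaves -/

/-- **Waldspurger's relation (W) from Tunnell's Theorem 3 (even twists)**: if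
`L(E²ⁿ, 1) = b(n)² β / (2 √(2n))` for odd square-free `n`, then both sides of (W) equal
`b(n₁)² b(n₂)² β / (2 √2)`. Hence (W) is equivalent to `Tunnell1983_L_one_even` (and to the other
three even-case leaves). [cite: Tunnell1983Congruent, Thm 3] -/
theorem b_sq_relation_of_L_one_even (hT : Tunnell1983_L_one_even) ⦃n₁ n₂ : ℕ⦄ (h₁ : Odd n₁)
    (hn₁ : Squarefree n₁) (hn₂ : Squarefree n₂) (h12 : n₁ % 8 = n₂ % 8)
    (hL₁ : (congruentNumberCurve (2 * n₁)).HasEntireLFunction)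
    (hL₂ : (congruentNumberCurve (2 * n₂)).HasEntireLFunction) :
    (Tunnell1983.b n₁ : ℂ) ^ 2 * (congruentNumberCurve (2 * n₂)).entireLFunction 1 *
        (Real.sqrt n₂ : ℂ) =
      (Tunnell1983.b n₂ : ℂ) ^ 2 * (congruentNumberCurve (2 * n₁)).entireLFunction 1 *
        (Real.sqrt n₁ : ℂ) := by
  have h₂ : Odd n₂ := Nat.odd_iff.mpr (by have := Nat.odd_iff.mp h₁; omega)
  rw [hT hn₁ h₁ hL₁, hT hn₂ h₂ hL₂]
  have hs₁ : (0 : ℝ) < Real.sqrt n₁ :=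
    Real.sqrt_pos.2 (by exact_mod_cast Nat.pos_of_ne_zero hn₁.ne_zero)
  have hs₂ : (0 : ℝ) < Real.sqrt n₂ :=
    Real.sqrt_pos.2 (by exact_mod_cast Nat.pos_of_ne_zero hn₂.ne_zero)
  have e₁ : Real.sqrt (2 * (n₁ : ℝ)) = Real.sqrt 2 * Real.sqrt n₁ := Real.sqrt_mul (by norm_num) _
  have e₂ : Real.sqrt (2 * (n₂ : ℝ)) = Real.sqrt 2 * Real.sqrt n₂ := Real.sqrt_mul (by norm_num) _
  rw [e₁, e₂]
  push_cast
  have hs2 : (Real.sqrt 2 : ℂ) ≠ 0 := Complex.ofReal_ne_zero.mpr (by positivity)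
  have hc₁ : (Real.sqrt n₁ : ℂ) ≠ 0 := Complex.ofReal_ne_zero.mpr hs₁.ne'
  have hc₂ : (Real.sqrt n₂ : ℂ) ≠ 0 := Complex.ofReal_ne_zero.mpr hs₂.ne'
  field_simp

/-! ### Corollaire 2 in the form of `TunnellWaldspurgerCorollaryProofs`, without Theorem 2 -/

/-- **`Tunnell1983_b_sq_propto_L_one` from Corollaire 2 at `(128, 3/2, χ₂, φ)`** (all
`f ∈ S_{3/2}(128, χ₂, φ)`), Theorem 2 (`χ₂`) being `Tunnell1983_thm2_chi2_holds`.
[cite: Waldspurger1981Fourier, Corollaire 2] [cite: Tunnell1983Congruent, Thm 2, p. 329] -/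
theorem Tunnell1983_b_sq_propto_L_one_of_waldspurgerCor
    (hW : ∀ f ∈ tunnellSubspace tunnellChar, ∀ ⦃n₁ n₂ : ℕ⦄, Odd n₁ → Squarefree n₁ →
      Squarefree n₂ → n₁ % 8 = n₂ % 8 →
      (congruentNumberCurve (2 * n₁)).HasEntireLFunction →
      (congruentNumberCurve (2 * n₂)).HasEntireLFunction →
      qCoeffs f n₁ ^ 2 * (congruentNumberCurve (2 * n₂)).entireLFunction 1 * (Real.sqrt n₂ : ℂ) =
        qCoeffs f n₂ ^ 2 * (congruentNumberCurve (2 * n₁)).entireLFunction 1 *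
          (Real.sqrt n₁ : ℂ)) :
    Tunnell1983_b_sq_propto_L_one :=
  Tunnell1983_b_sq_propto_L_one_of_thm2_of_waldspurgerCor Tunnell1983_thm2_chi2_holds hW

/-- **`Tunnell1983_waldspurger_chi2` from Corollaire 2**, Theorem 2 (`χ₂`) being a theorem.
[cite: Waldspurger1981Fourier, Thm 1 and Corollaire 2] [cite: Tunnell1983Congruent, pp. 328–329] -/
theorem Tunnell1983_waldspurger_chi2_of_waldspurgerCor
    (hW : ∀ f ∈ tunnellSubspace tunnellChar, ∀ ⦃n₁ n₂ : ℕ⦄, Odd n₁ → Squarefree n₁ →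
      Squarefree n₂ → n₁ % 8 = n₂ % 8 →
      (congruentNumberCurve (2 * n₁)).HasEntireLFunction →
      (congruentNumberCurve (2 * n₂)).HasEntireLFunction →
      qCoeffs f n₁ ^ 2 * (congruentNumberCurve (2 * n₂)).entireLFunction 1 * (Real.sqrt n₂ : ℂ) =
        qCoeffs f n₂ ^ 2 * (congruentNumberCurve (2 * n₁)).entireLFunction 1 *
          (Real.sqrt n₁ : ℂ)) :
    Tunnell1983_waldspurger_chi2 :=
  Tunnell1983_waldspurger_chi2_of_thm2_of_waldspurgerCor Tunnell1983_thm2_chi2_holds hW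

/-- **Tunnell's Theorem 3, even twists, from Corollaire 2**, Theorem 2 (`χ₂`) being a theorem.
[cite: Tunnell1983Congruent, Thm 3 and its proof, p. 329] [cite: Waldspurger1981Fourier, Corollaire 2] -/
theorem Tunnell1983_L_one_even_of_waldspurgerCor
    (hW : ∀ f ∈ tunnellSubspace tunnellChar, ∀ ⦃n₁ n₂ : ℕ⦄, Odd n₁ → Squarefree n₁ →
      Squarefree n₂ → n₁ % 8 = n₂ % 8 →
      (congruentNumberCurve (2 * n₁)).HasEntireLFunction →
      (congruentNumberCurve (2 * n₂)).HasEntireLFunction →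
      qCoeffs f n₁ ^ 2 * (congruentNumberCurve (2 * n₂)).entireLFunction 1 * (Real.sqrt n₂ : ℂ) =
        qCoeffs f n₂ ^ 2 * (congruentNumberCurve (2 * n₁)).entireLFunction 1 *
          (Real.sqrt n₁ : ℂ)) :
    Tunnell1983_L_one_even :=
  Tunnell1983_L_one_even_of_thm2_of_waldspurgerCor Tunnell1983_thm2_chi2_holds hW

/-- **`tunnell_converse_even` from Corollaire 2 at `(128, 3/2, χ₂, φ)` alone**, Theorem 2 (`χ₂`)
being a theorem. [cite: KoblitzECMF1993, Ch. IV §4, Theorem (Tunnell)]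
[cite: Tunnell1983Congruent, §3 (p. 330)] [cite: Waldspurger1981Fourier, Corollaire 2] -/
theorem tunnell_converse_even_of_waldspurgerCor
    (hW : ∀ f ∈ tunnellSubspace tunnellChar, ∀ ⦃n₁ n₂ : ℕ⦄, Odd n₁ → Squarefree n₁ →
      Squarefree n₂ → n₁ % 8 = n₂ % 8 →
      (congruentNumberCurve (2 * n₁)).HasEntireLFunction →
      (congruentNumberCurve (2 * n₂)).HasEntireLFunction →
      qCoeffs f n₁ ^ 2 * (congruentNumberCurve (2 * n₂)).entireLFunction 1 * (Real.sqrt n₂ : ℂ) =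
        qCoeffs f n₂ ^ 2 * (congruentNumberCurve (2 * n₁)).entireLFunction 1 *
          (Real.sqrt n₁ : ℂ)) :
    tunnell_converse_even :=
  tunnell_converse_even_of_thm2_of_waldspurgerCor Tunnell1983_thm2_chi2_holds hW

end Literature.NumberTheory.EllipticCurves

end
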